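import Mathlib
import Literature.NumberTheory.LFunctions.MoebiusHarmonicSumBound
import HarnessLib

/-!
# Zero-mode lemma for closed-horocycle averages: `∑_{c≥1} (φ(c)/c) k(λc) = A/λ + O(1)`

Topic `Literature/NumberTheory/LFunctions` (trunk T-ANT). Everything in this file is PROVED
(no named facts). It is the first input of an elementary proof of the unconditional rate
`m_F(y) = c + O(y^{1/2})` for horocycle averages on `SL(2,ℤ)\ℍ`
(`Literature.NumberTheory.LFunctions.zagier_horocycle_rate_half`, `HorocycleRH.lean`; Sarnak 1981 Thm. 1, Zagier 1981 §1):
after unfolding `∫₀¹ F(x+iy) dx` over `Γ_∞\Γ/Γ_∞` (Iwaniec, *Spectral methods*, §3.4, (3.17)),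
the zero Fourier mode contributes `2√y ∑_{c ≥ 1} (φ(c)/c) k(c√y)` for a compactly supported
`C²` function `k`, and this file evaluates such sums:

* `Literature.NumberTheory.LFunctions.HorocycleZeroMode.zeroMode_bound` — for `k : ℝ → ℂ` of class `C²` with `k = 0` on
  `[R, ∞)`, there is `C` with
  `‖∑_{1 ≤ c ≤ N} (φ(c)/c) k(l c) - (∑_d μ(d)/d²) (∫_0^R k) / l‖ ≤ C` for all `l > 0` and all
  `N ≥ R/l` (the sum does not depend on such `N`).

Proof (elementary). `φ(c)/c = ∑_{d ∣ c} μ(d)/d` (Möbius inversion of `∑_{d∣c} φ(d) = c`,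
`totient_div_eq_sum_moebius_div`), so the sum is `∑_d (μ(d)/d) ∑_{m ≥ 1} k(l d m)`
(`sum_totient_div_mul_eq`). Each row is evaluated by the trapezoidal rule with exact remainder
(`integral_unit_eq_trapezoid`, `norm_sum_sub_integral_le`, `norm_row_sub_le`):
`∑_{m ≥ 1} k(a m) = (1/a)∫_0^∞ k - k(0)/2 + O(a ∫|k''|)`. Summing over `d ≤ R/l` gives the main
term `(∫k / l) ∑_{d ≤ D} μ(d)/d²`, whose completion costs `∑_{d > D} d⁻² ≤ 2/(D+1)`
(`norm_tsum_moebius_div_sq_sub_le`, from Mathlib's `sum_Ioo_inv_sq_le`), the term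
`-(k(0)/2) ∑_{d ≤ D} μ(d)/d = O(1)` by the tree's PROVED `Literature.NumberTheory.LFunctions.tendsto_sum_moebius_div_zero`
(`exists_bound_sum_moebius_div`), and the remainders add up to `≤ R ∫|k''| / 8`.

## References

* H. Iwaniec, *Spectral Methods of Automorphic Forms*, 2nd ed., AMS GSM 53 (2002), §3.4
  [Iwaniec2002].
* P. Sarnak, *Asymptotic behavior of periodic orbits of the horocycle flow and Eisenstein
  series*, Comm. Pure Appl. Math. 34 (1981), 719–739, Thm. 1 [Sarnak1981].

## Mathlib search

Mathlib: `ArithmeticFunction.sum_eq_iff_sum_smul_moebius_eq`, `Nat.sum_totient`,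
`Nat.divisorsAntidiagonal_eq_prod_filter_of_le` (the proof of
`ArithmeticFunction.sum_Ioc_mul_eq_sum_sum` is replayed for a general summand),
`intervalIntegral.integral_mul_deriv_eq_deriv_mul`, `sum_Ioo_inv_sq_le`,
`Metric.isBounded_range_of_tendsto`. Tree: `Literature.NumberTheory.LFunctions.tendsto_sum_moebius_div_zero`
(`MoebiusHarmonicSumBound.lean`). Nothing on totient-weighted smooth sums
(`lean search 'totient.*smooth|sum_totient_div'`).
-/


noncomputable section

open Real MeasureTheory Set Filter Finset intervalIntegral

namespace Literature.NumberTheory.LFunctions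

namespace HorocycleZeroMode

/-- Trapezoidal rule on a unit interval with the exact second-derivative remainder:
`∫_m^{m+1} G = (G(m) + G(m+1))/2 + ∫_m^{m+1} ((t-m)(t-m-1)/2) G''(t) dt`. [folklore] -/
theorem integral_unit_eq_trapezoid {G G' G'' : ℝ → ℂ} (m : ℝ)
    (hG : ∀ t, HasDerivAt G (G' t) t) (hG' : ∀ t, HasDerivAt G' (G'' t) t)
    (hG'c : Continuous G') (hG''c : Continuous G'') :
    ∫ t in m..(m + 1), G t =
      (G m + G (m + 1)) / 2 +
        ∫ t in m..(m + 1), (((t : ℂ) - m) * ((t : ℂ) - m - 1) / 2) * G'' t := by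
  have hGc : Continuous G := continuous_iff_continuousAt.2 fun t => (hG t).continuousAt
  -- `u₁ = t - m - 1/2`, `u₁' = 1`
  have hu₁ : ∀ t : ℝ, HasDerivAt (fun t : ℝ => (t : ℂ) - m - 1 / 2) 1 t := fun t => by
    simpa using (((hasDerivAt_id t).ofReal_comp).sub_const (m : ℂ)).sub_const (1 / 2 : ℂ)
  -- `p = (t-m)(t-m-1)/2`, `p' = u₁`
  have hp : ∀ t : ℝ, HasDerivAt (fun t : ℝ => ((t : ℂ) - m) * ((t : ℂ) - m - 1) / 2)
      ((t : ℂ) - m - 1 / 2) t := fun t => by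
    have h1 : HasDerivAt (fun t : ℝ => (t : ℂ) - m) 1 t := by
      simpa using ((hasDerivAt_id t).ofReal_comp).sub_const (m : ℂ)
    have h2 : HasDerivAt (fun t : ℝ => (t : ℂ) - m - 1) 1 t := by
      simpa using (((hasDerivAt_id t).ofReal_comp).sub_const (m : ℂ)).sub_const (1 : ℂ)
    refine ((h1.mul h2).div_const 2).congr_deriv ?_
    ring
  have i1 := intervalIntegral.integral_mul_deriv_eq_deriv_mul (a := m) (b := m + 1)
    (u := fun t : ℝ => (t : ℂ) - m - 1 / 2) (u' := fun _ => (1 : ℂ)) (v := G) (v' := G')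
    (fun t _ => hu₁ t) (fun t _ => hG t) intervalIntegrable_const
    (hG'c.intervalIntegrable _ _)
  have i2 := intervalIntegral.integral_mul_deriv_eq_deriv_mul (a := m) (b := m + 1)
    (u := fun t : ℝ => ((t : ℂ) - m) * ((t : ℂ) - m - 1) / 2)
    (u' := fun t : ℝ => (t : ℂ) - m - 1 / 2) (v := G') (v' := G'')
    (fun t _ => hp t) (fun t _ => hG' t)
    ((Complex.continuous_ofReal.sub continuous_const).sub continuous_const
      |>.intervalIntegrable _ _)
    (hG''c.intervalIntegrable _ _)
  simp only [one_mul] at i1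
  have e1 : ∫ t in m..(m + 1), G t =
      (G m + G (m + 1)) / 2 - ∫ t in m..(m + 1), ((t : ℂ) - m - 1 / 2) * G' t := by
    rw [i1]; push_cast; ring
  rw [e1, i2]
  push_cast
  ring

/-- `|(t-m)(t-m-1)/2| ≤ 1/8` on `[m, m+1]`. [folklore] -/
theorem norm_kernel_le {m t : ℝ} (ht : t ∈ Icc m (m + 1)) :
    ‖((t : ℂ) - m) * ((t : ℂ) - m - 1) / 2‖ ≤ 1 / 8 := by
  have h : ((t : ℂ) - m) * ((t : ℂ) - m - 1) / 2 = (((t - m) * (t - m - 1) / 2 : ℝ) : ℂ) := by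
    push_cast; ring
  rw [h, Complex.norm_real, Real.norm_eq_abs]
  have h0 : 0 ≤ t - m := by linarith [ht.1]
  have h1 : t - m ≤ 1 := by linarith [ht.2]
  rw [abs_le]
  constructor <;> nlinarith [sq_nonneg (t - m - 1 / 2)]

/-- **Trapezoidal rule with second-derivative remainder** (summed over `[0, M]`): for `G` twice
continuously differentiable,
`‖∑_{m=0}^{M} G(m) - (G(0) + G(M))/2 - ∫_0^M G‖ ≤ (1/8) ∫_0^M ‖G''‖`. [folklore] -/
theorem norm_sum_sub_integral_le {G G' G'' : ℝ → ℂ}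
    (hG : ∀ t, HasDerivAt G (G' t) t) (hG' : ∀ t, HasDerivAt G' (G'' t) t)
    (hG'c : Continuous G') (hG''c : Continuous G'') (M : ℕ) :
    ‖∑ m ∈ Finset.range (M + 1), G m - (G 0 + G M) / 2 - ∫ t in (0 : ℝ)..M, G t‖ ≤
      (1 / 8) * ∫ t in (0 : ℝ)..M, ‖G'' t‖ := by
  have hGc : Continuous G := continuous_iff_continuousAt.2 fun t => (hG t).continuousAt
  -- the remainders
  set R : ℕ → ℂ := fun m =>
    ∫ t in (m : ℝ)..(m + 1), (((t : ℂ) - m) * ((t : ℂ) - m - 1) / 2) * G'' t with hR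
  have hunit : ∀ m : ℕ, ∫ t in (m : ℝ)..(m + 1), G t = (G m + G (m + 1)) / 2 + R m := fun m => by
    rw [hR]
    exact_mod_cast integral_unit_eq_trapezoid (m : ℝ) hG hG' hG'c hG''c
  -- sum of the unit integrals
  have hadj : ∑ m ∈ Finset.range M, ∫ t in (m : ℝ)..(m + 1), G t = ∫ t in (0 : ℝ)..M, G t := by
    have := intervalIntegral.sum_integral_adjacent_intervals (a := fun k : ℕ => (k : ℝ)) (n := M)
      (f := G) (μ := volume) (fun k _ => hGc.intervalIntegrable _ _)
    simpa using this
  have hadj'' : ∑ m ∈ Finset.range M, ∫ t in (m : ℝ)..(m + 1), ‖G'' t‖ =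
      ∫ t in (0 : ℝ)..M, ‖G'' t‖ := by
    have := intervalIntegral.sum_integral_adjacent_intervals (a := fun k : ℕ => (k : ℝ)) (n := M)
      (f := fun t => ‖G'' t‖) (μ := volume) (fun k _ => hG''c.norm.intervalIntegrable _ _)
    simpa using this
  -- telescoping the trapezoid values
  have htel : ∑ m ∈ Finset.range M, (G m + G (m + 1)) / 2 =
      ∑ m ∈ Finset.range (M + 1), G m - (G 0 + G M) / 2 := by
    have h1 := Finset.sum_range_succ (fun m : ℕ => G m) M
    have h2 := Finset.sum_range_succ' (fun m : ℕ => G m) M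
    push_cast at h2
    rw [← Finset.sum_div, Finset.sum_add_distrib]
    linear_combination (-1 / 2 : ℂ) * h1 + (-1 / 2 : ℂ) * h2
  -- the remainder bound
  have hRle : ∀ m : ℕ, ‖R m‖ ≤ (1 / 8) * ∫ t in (m : ℝ)..(m + 1), ‖G'' t‖ := fun m => by
    rw [hR]
    have hle : (m : ℝ) ≤ m + 1 := by linarith
    calc ‖∫ t in (m : ℝ)..(m + 1), (((t : ℂ) - m) * ((t : ℂ) - m - 1) / 2) * G'' t‖
        ≤ ∫ t in (m : ℝ)..(m + 1), ‖(((t : ℂ) - m) * ((t : ℂ) - m - 1) / 2) * G'' t‖ :=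
          intervalIntegral.norm_integral_le_integral_norm hle
      _ ≤ ∫ t in (m : ℝ)..(m + 1), (1 / 8) * ‖G'' t‖ := by
          refine intervalIntegral.integral_mono_on hle ?_ ?_ fun t ht => ?_
          · exact ((((Complex.continuous_ofReal.sub continuous_const).mul
              ((Complex.continuous_ofReal.sub continuous_const).sub continuous_const)).div_const
              _).mul hG''c).norm.intervalIntegrable _ _
          · exact (hG''c.norm.const_mul _).intervalIntegrable _ _
          · rw [norm_mul]
            exact mul_le_mul_of_nonneg_right (norm_kernel_le ht) (norm_nonneg _)
      _ = (1 / 8) * ∫ t in (m : ℝ)..(m + 1), ‖G'' t‖ := intervalIntegral.integral_const_mul _ _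
  -- assemble
  have key : ∑ m ∈ Finset.range (M + 1), G m - (G 0 + G M) / 2 - ∫ t in (0 : ℝ)..M, G t =
      -∑ m ∈ Finset.range M, R m := by
    rw [← hadj, Finset.sum_congr rfl fun m _ => hunit m, Finset.sum_add_distrib, htel]
    ring
  rw [key, norm_neg, ← hadj'', Finset.mul_sum]
  exact (norm_sum_le _ _).trans (Finset.sum_le_sum fun m _ => hRle m)


/-! ### Möbius inversion for the totient; divisor-sum rearrangement -/

open scoped ArithmeticFunction.Moebius in
/-- `φ(n)/n = ∑_{d ∣ n} μ(d)/d` (`n ≥ 1`), Möbius inversion of `∑_{d ∣ n} φ(d) = n`. [folklore] -/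
theorem totient_div_eq_sum_moebius_div {n : ℕ} (hn : 0 < n) :
    ((Nat.totient n : ℂ) / n) = ∑ d ∈ n.divisors, (μ d : ℂ) / d := by
  have key : ∀ n > 0, ∑ x ∈ n.divisorsAntidiagonal, (μ x.fst : ℤ) • ((x.snd : ℕ) : ℤ) =
      (Nat.totient n : ℤ) := by
    refine (ArithmeticFunction.sum_eq_iff_sum_smul_moebius_eq (R := ℤ)
      (f := fun n => (Nat.totient n : ℤ)) (g := fun n => ((n : ℕ) : ℤ))).mp ?_
    intro n _
    exact_mod_cast Nat.sum_totient n
  have h := key n hn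
  rw [Nat.sum_divisorsAntidiagonal (f := fun a b => (μ a : ℤ) • ((b : ℕ) : ℤ))] at h
  have hn' : (n : ℂ) ≠ 0 := by exact_mod_cast hn.ne'
  rw [div_eq_iff hn', Finset.sum_mul]
  have h' := congrArg (fun z : ℤ => (z : ℂ)) h
  simp only [zsmul_eq_mul, Int.cast_id, Int.cast_sum, Int.cast_mul, Int.cast_natCast] at h'
  rw [← h']
  refine Finset.sum_congr rfl fun d hd => ?_
  have hd0 : 0 < d := Nat.pos_of_mem_divisors hd
  have hdvd : d ∣ n := Nat.dvd_of_mem_divisors hd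
  rw [Nat.cast_div hdvd (by exact_mod_cast hd0.ne')]
  field_simp

/-- Rearrangement `∑_{c ≤ N} ∑_{dm = c} g(d, m) = ∑_{d ≤ N} ∑_{m ≤ N/d} g(d, m)` (the proof of
Mathlib's `ArithmeticFunction.sum_Ioc_mul_eq_sum_sum`, for a general summand). [folklore] -/
theorem sum_Ioc_sum_divisorsAntidiagonal {α : Type*} [AddCommMonoid α] (g : ℕ → ℕ → α) (N : ℕ) :
    ∑ c ∈ Finset.Ioc 0 N, ∑ x ∈ c.divisorsAntidiagonal, g x.1 x.2 =
      ∑ d ∈ Finset.Ioc 0 N, ∑ m ∈ Finset.Ioc 0 (N / d), g d m := by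
  trans ∑ n ∈ Finset.Ioc 0 N, ∑ x ∈ Finset.Ioc 0 N ×ˢ Finset.Ioc 0 N with x.1 * x.2 = n, g x.1 x.2
  · refine sum_congr rfl fun n hn => ?_
    simp only [Finset.mem_Ioc] at hn
    rw [Nat.divisorsAntidiagonal_eq_prod_filter_of_le hn.1.ne' hn.2]
  trans ∑ x ∈ Finset.Ioc 0 N ×ˢ Finset.Ioc 0 N with x.1 * x.2 ≤ N, g x.1 x.2
  · simp_rw [sum_filter]
    rw [sum_comm]
    exact sum_congr rfl fun _ _ => (by simp_all)
  rw [sum_filter, sum_product]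
  refine sum_congr rfl fun n hn => ?_
  simp only [sum_ite, not_le, sum_const_zero, add_zero]
  congr
  ext
  simp only [mem_filter, Finset.mem_Ioc, and_assoc, and_congr_right_iff] at hn ⊢
  intro _
  constructor
  · intro ⟨_, h⟩
    grw [← h, Nat.mul_div_cancel_left _ (by lia)]
  · intro hm
    grw [hm]
    simp [Nat.mul_div_le, Nat.div_le_self]

open scoped ArithmeticFunction.Moebius in
/-- `∑_{c ≤ N} (φ(c)/c) k(l c) = ∑_{d ≤ N} (μ(d)/d) ∑_{m ≤ N/d} k(l d m)`. [folklore] -/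
theorem sum_totient_div_mul_eq (k : ℝ → ℂ) (l : ℝ) (N : ℕ) :
    ∑ c ∈ Finset.Ioc 0 N, ((Nat.totient c : ℂ) / c) * k (l * c) =
      ∑ d ∈ Finset.Ioc 0 N, ((μ d : ℂ) / d) * ∑ m ∈ Finset.Ioc 0 (N / d), k (l * (d * m : ℕ)) := by
  have h1 : ∀ c ∈ Finset.Ioc 0 N, ((Nat.totient c : ℂ) / c) * k (l * c) =
      ∑ x ∈ c.divisorsAntidiagonal, ((μ x.1 : ℂ) / x.1) * k (l * (x.1 * x.2 : ℕ)) := by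
    intro c hc
    have hc0 : 0 < c := (Finset.mem_Ioc.1 hc).1
    rw [totient_div_eq_sum_moebius_div hc0, Finset.sum_mul,
      Nat.sum_divisorsAntidiagonal (f := fun a b => ((μ a : ℂ) / a) * k (l * (a * b : ℕ)))]
    refine sum_congr rfl fun d hd => ?_
    rw [Nat.mul_div_cancel' (Nat.dvd_of_mem_divisors hd)]
  have h2 := sum_Ioc_sum_divisorsAntidiagonal
    (fun d m => ((μ d : ℂ) / d) * k (l * (d * m : ℕ))) N
  beta_reduce at h2
  rw [sum_congr rfl h1, h2]
  simp_rw [Finset.mul_sum]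

/-! ### One row: `∑_{m ≥ 1} k(a m)` by the trapezoidal rule -/

/-- Unpacking `ContDiff ℝ 2`. [folklore] -/
theorem hasDerivAt_of_contDiff_two {k : ℝ → ℂ} (hk : ContDiff ℝ 2 k) :
    (∀ t, HasDerivAt k (deriv k t) t) ∧ (∀ t, HasDerivAt (deriv k) (deriv (deriv k) t) t) ∧
      Continuous (deriv k) ∧ Continuous (deriv (deriv k)) := by
  rw [show (2 : WithTop ℕ∞) = 1 + 1 by norm_num] at hk
  obtain ⟨hd, -, hk1⟩ := contDiff_succ_iff_deriv.mp hk
  rw [show (1 : WithTop ℕ∞) = 0 + 1 by norm_num] at hk1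
  obtain ⟨hd1, -, hk0⟩ := contDiff_succ_iff_deriv.mp hk1
  exact ⟨fun t => (hd t).hasDerivAt, fun t => (hd1 t).hasDerivAt, hd1.continuous,
    contDiff_zero.mp hk0⟩

/-- A `C²` function vanishing on `[R, ∞)` has first and second derivative vanishing on
`(R, ∞)`. [folklore] -/
theorem deriv_deriv_eq_zero_of_gt {k : ℝ → ℂ} {R : ℝ} (hkR : ∀ s, R ≤ s → k s = 0) {s : ℝ}
    (hs : R < s) : deriv k s = 0 ∧ deriv (deriv k) s = 0 := by
  have hev : ∀ s, R < s → k =ᶠ[nhds s] fun _ => (0 : ℂ) := fun s hs =>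
    (eventually_gt_nhds hs).mono fun t ht => hkR t ht.le
  have hd : ∀ s, R < s → deriv k s = 0 := fun s hs => by
    rw [(hev s hs).deriv_eq]; exact deriv_const s 0
  refine ⟨hd s hs, ?_⟩
  have hev' : deriv k =ᶠ[nhds s] fun _ => (0 : ℂ) :=
    (eventually_gt_nhds hs).mono fun t ht => hd t ht
  rw [hev'.deriv_eq]; exact deriv_const s 0

/-- **One row.** For `k ∈ C²` vanishing on `[R, ∞)`, `a > 0` and `M a ≥ R`:
`∑_{m=0}^{M} k(m a) = (1/a) ∫_0^R k + k(0)/2 + E`, `‖E‖ ≤ (a/8) ∫_0^R ‖k''‖`. [folklore] -/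
theorem norm_row_sub_le {k : ℝ → ℂ} (hk : ContDiff ℝ 2 k) {R : ℝ}
    (hkR : ∀ s, R ≤ s → k s = 0) {a : ℝ} (ha : 0 < a) {M : ℕ} (hM : R ≤ M * a) :
    ‖∑ m ∈ Finset.range (M + 1), k (m * a) - (∫ s in (0 : ℝ)..R, k s) / a - k 0 / 2‖ ≤
      (a / 8) * ∫ s in (0 : ℝ)..R, ‖deriv (deriv k) s‖ := by
  obtain ⟨h1, h2, hc1, hc2⟩ := hasDerivAt_of_contDiff_two hk
  -- the scaled function and its derivatives
  set G : ℝ → ℂ := fun t => k (t * a) with hG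
  set G' : ℝ → ℂ := fun t => a • deriv k (t * a) with hG'
  set G'' : ℝ → ℂ := fun t => a • (a • deriv (deriv k) (t * a)) with hG''
  have hGd : ∀ t, HasDerivAt G (G' t) t := fun t => (h1 (t * a)).scomp t (hasDerivAt_mul_const a)
  have hG'd : ∀ t, HasDerivAt G' (G'' t) t := fun t =>
    ((h2 (t * a)).scomp t (hasDerivAt_mul_const a)).const_smul a
  have hG'c : Continuous G' := (hc1.comp (continuous_id.mul continuous_const)).const_smul a
  have hG''c : Continuous G'' :=
    ((hc2.comp (continuous_id.mul continuous_const)).const_smul a).const_smul a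
  have htrap := norm_sum_sub_integral_le hGd hG'd hG'c hG''c M
  -- `G M = 0`
  have hGM : G M = 0 := hkR _ hM
  -- `∫_0^M G = (1/a) ∫_0^R k`
  have hMa : R ≤ (M : ℝ) * a := hM
  have hintG : ∫ t in (0 : ℝ)..M, G t = (∫ s in (0 : ℝ)..R, k s) / a := by
    have hsub : ∫ t in (0 : ℝ)..M, G t = a⁻¹ • ∫ s in (0 * a)..(M * a), k s := by
      rw [hG]; exact intervalIntegral.integral_comp_mul_right (fun s => k s) ha.ne'
    rw [hsub, zero_mul]
    have hsplit : ∫ s in (0 : ℝ)..(M * a), k s = (∫ s in (0 : ℝ)..R, k s) + ∫ s in R..(M * a), k s :=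
      (intervalIntegral.integral_add_adjacent_intervals
        ((hk.continuous.intervalIntegrable _ _)) (hk.continuous.intervalIntegrable _ _)).symm
    have hzero : ∫ s in R..(M * a), k s = 0 := by
      rw [intervalIntegral.integral_congr (g := fun _ => (0 : ℂ)) fun s hs => ?_]
      · simp
      · rw [uIcc_of_le hMa] at hs; exact hkR s hs.1
    rw [hsplit, hzero, add_zero, Complex.real_smul, Complex.ofReal_inv, div_eq_inv_mul]
  -- `∫_0^M ‖G''‖ = a ∫_0^R ‖k''‖`
  have hintG'' : ∫ t in (0 : ℝ)..M, ‖G'' t‖ = a * ∫ s in (0 : ℝ)..R, ‖deriv (deriv k) s‖ := by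
    have hsub : ∫ t in (0 : ℝ)..M, ‖G'' t‖ =
        a⁻¹ • ∫ s in (0 * a)..(M * a), ‖a • (a • deriv (deriv k) s)‖ := by
      rw [hG'']
      exact intervalIntegral.integral_comp_mul_right (fun s => ‖a • (a • deriv (deriv k) s)‖)
        ha.ne'
    rw [hsub, zero_mul]
    have hsplit : ∫ s in (0 : ℝ)..(M * a), ‖a • (a • deriv (deriv k) s)‖ =
        (∫ s in (0 : ℝ)..R, ‖a • (a • deriv (deriv k) s)‖) +
          ∫ s in R..(M * a), ‖a • (a • deriv (deriv k) s)‖ := by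
      have hc : Continuous fun s => ‖a • (a • deriv (deriv k) s)‖ :=
        ((hc2.const_smul a).const_smul a).norm
      exact (intervalIntegral.integral_add_adjacent_intervals (hc.intervalIntegrable _ _)
        (hc.intervalIntegrable _ _)).symm
    have hzero : ∫ s in R..(M * a), ‖a • (a • deriv (deriv k) s)‖ = 0 := by
      rw [intervalIntegral.integral_of_le hMa]
      refine MeasureTheory.setIntegral_eq_zero_of_forall_eq_zero fun s hs => ?_
      rw [(deriv_deriv_eq_zero_of_gt hkR hs.1).2]; simp
    rw [hsplit, hzero, add_zero]
    have : (fun s => ‖a • (a • deriv (deriv k) s)‖) = fun s => (a * a) * ‖deriv (deriv k) s‖ := by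
      funext s
      rw [norm_smul, norm_smul, Real.norm_of_nonneg ha.le]; ring
    rw [this, intervalIntegral.integral_const_mul, smul_eq_mul]
    field_simp
  -- assemble
  have e1 : ∑ m ∈ Finset.range (M + 1), k (m * a) - (∫ s in (0 : ℝ)..R, k s) / a - k 0 / 2 =
      ∑ m ∈ Finset.range (M + 1), G m - (G 0 + G M) / 2 - ∫ t in (0 : ℝ)..M, G t := by
    rw [hGM, hintG]; simp only [hG, zero_mul, add_zero]; ring
  rw [e1]
  refine htrap.trans ?_
  rw [hintG'']
  exact le_of_eq (by ring)


/-! ### The Möbius inputs: bounded `∑ μ(d)/d`, and the tail of `∑ μ(d)/d²` -/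

/-- `∑_{m ∈ (0, n]} f(m) = ∑_{i < n} f(i+1)`. [folklore] -/
theorem sum_Ioc_zero_eq_sum_range {α : Type*} [AddCommMonoid α] (f : ℕ → α) (n : ℕ) :
    ∑ m ∈ Finset.Ioc 0 n, f m = ∑ i ∈ Finset.range n, f (i + 1) := by
  induction n with
  | zero => simp
  | succ n ih => rw [Finset.sum_Ioc_succ_top (Nat.zero_le _), ih, Finset.sum_range_succ]

open scoped ArithmeticFunction.Moebius in
/-- Bounded partial sums of `∑ μ(d)/d` (a consequence of the tree's PROVED
`Literature.NumberTheory.LFunctions.tendsto_sum_moebius_div_zero`, i.e. `∑ μ(d)/d = 0`; only boundedness is used here).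
[folklore] -/
theorem exists_bound_sum_moebius_div :
    ∃ B : ℝ, ∀ D : ℕ, ‖∑ d ∈ Finset.Ioc 0 D, (μ d : ℂ) / d‖ ≤ B := by
  obtain ⟨B, hB⟩ := isBounded_iff_forall_norm_le.mp
    (Metric.isBounded_range_of_tendsto _ Literature.NumberTheory.LFunctions.tendsto_sum_moebius_div_zero)
  refine ⟨B, fun D => ?_⟩
  have h := hB _ (Set.mem_range_self D)
  have e : ∑ d ∈ Finset.Ioc 0 D, (μ d : ℂ) / d =
      ((∑ d ∈ Finset.Icc 1 D, (μ d : ℝ) / d : ℝ) : ℂ) := by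
    rw [show Finset.Ioc 0 D = Finset.Icc 1 D by ext; simp only [Finset.mem_Ioc, Finset.mem_Icc]; omega]
    push_cast; rfl
  rwa [e, Complex.norm_real]

open scoped ArithmeticFunction.Moebius in
/-- `d ↦ μ(d)/d²` is absolutely summable. [folklore] -/
theorem summable_moebius_div_sq : Summable fun d : ℕ => (μ d : ℂ) / (d : ℂ) ^ 2 := by
  refine Summable.of_norm_bounded (Real.summable_one_div_nat_pow.mpr one_lt_two) fun d => ?_
  rw [norm_div, norm_pow, Complex.norm_natCast, Complex.norm_intCast]
  rcases Nat.eq_zero_or_pos d with rfl | hd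
  · simp
  · exact div_le_div_of_nonneg_right (by exact_mod_cast ArithmeticFunction.abs_moebius_le_one)
      (by positivity)

open scoped ArithmeticFunction.Moebius in
/-- The tail `|∑_{d > D} μ(d)/d²| ≤ 2/(D+1)`. [folklore] -/
theorem norm_tsum_moebius_div_sq_sub_le (D : ℕ) :
    ‖(∑' d : ℕ, (μ d : ℂ) / (d : ℂ) ^ 2) - ∑ d ∈ Finset.Ioc 0 D, (μ d : ℂ) / (d : ℂ) ^ 2‖ ≤
      2 / (D + 1) := by
  set f : ℕ → ℂ := fun d => (μ d : ℂ) / (d : ℂ) ^ 2 with hf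
  have hs : Summable f := summable_moebius_div_sq
  have hsplit := hs.sum_add_tsum_nat_add (D + 1)
  have hrange : ∑ i ∈ Finset.range (D + 1), f i = ∑ d ∈ Finset.Ioc 0 D, f d := by
    rw [Finset.sum_range_succ', sum_Ioc_zero_eq_sum_range]
    simp [hf]
  have htail : (∑' d : ℕ, f d) - ∑ d ∈ Finset.Ioc 0 D, f d = ∑' i : ℕ, f (i + (D + 1)) := by
    rw [← hsplit, hrange]; ring
  rw [htail]
  have hbound : ∀ i : ℕ, ‖f (i + (D + 1))‖ ≤ 1 / ((i + (D + 1) : ℕ) : ℝ) ^ 2 := fun i => by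
    rw [hf]
    dsimp only
    rw [norm_div, norm_pow, Complex.norm_natCast, Complex.norm_intCast]
    exact div_le_div_of_nonneg_right (by exact_mod_cast ArithmeticFunction.abs_moebius_le_one)
      (by positivity)
  have hs1 : Summable fun i : ℕ => 1 / ((i + (D + 1) : ℕ) : ℝ) ^ 2 :=
    (summable_nat_add_iff (f := fun n : ℕ => 1 / (n : ℝ) ^ 2) (D + 1)).mpr
      (Real.summable_one_div_nat_pow.mpr one_lt_two)
  have hsn : Summable fun i : ℕ => ‖f (i + (D + 1))‖ := Summable.of_nonneg_of_le
    (fun _ => norm_nonneg _) hbound hs1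
  refine (norm_tsum_le_tsum_norm hsn).trans ?_
  refine (Summable.tsum_le_tsum hbound hsn hs1).trans ?_
  refine Real.tsum_le_of_sum_range_le (fun _ => by positivity) fun n => ?_
  have h := sum_Ioo_inv_sq_le (α := ℝ) D (D + 1 + n)
  have e : ∑ i ∈ Finset.range n, 1 / ((i + (D + 1) : ℕ) : ℝ) ^ 2 =
      ∑ i ∈ Finset.Ioo D (D + 1 + n), ((i : ℝ) ^ 2)⁻¹ := by
    rw [show Finset.Ioo D (D + 1 + n) = Finset.Ico (D + 1) (D + 1 + n) by
      ext; simp only [Finset.mem_Ioo, Finset.mem_Ico]; omega,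
      Finset.sum_Ico_eq_sum_range]
    simp only [add_tsub_cancel_left, one_div]
    refine Finset.sum_congr rfl fun i _ => ?_
    push_cast; ring
  rw [e]; exact h

/-! ### The main estimate -/

open scoped ArithmeticFunction.Moebius in
/-- **Zero-mode lemma.** Let `k : ℝ → ℂ` be `C²` with `k = 0` on `[R, ∞)` (`R > 0`). Then
`∑_{c ≥ 1} (φ(c)/c) k(l c) = (∑_d μ(d)/d²) (∫_0^R k) / l + O(1)` uniformly in `l > 0`
(the sum is finite; any `N ≥ R/l` captures it). Proof: `φ(c)/c = ∑_{d∣c} μ(d)/d`, the inner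
sums `∑_m k(l d m)` by the trapezoidal rule, `∑_{d ≤ D} μ(d)/d = O(1)` (tree) and
`∑_{d > D} 1/d² ≤ 2/(D+1)`. [folklore] -/
theorem zeroMode_bound {k : ℝ → ℂ} (hk : ContDiff ℝ 2 k) {R : ℝ} (hR : 0 < R)
    (hkR : ∀ s, R ≤ s → k s = 0) :
    ∃ C : ℝ, ∀ l : ℝ, 0 < l → ∀ N : ℕ, R ≤ l * N →
      ‖∑ c ∈ Finset.Ioc 0 N, ((Nat.totient c : ℂ) / c) * k (l * c) -
        (∑' d : ℕ, (μ d : ℂ) / (d : ℂ) ^ 2) * (∫ s in (0 : ℝ)..R, k s) / l‖ ≤ C := by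
  obtain ⟨Bμ, hBμ⟩ := exists_bound_sum_moebius_div
  set I : ℂ := ∫ s in (0 : ℝ)..R, k s with hI
  set K₂ : ℝ := ∫ s in (0 : ℝ)..R, ‖deriv (deriv k) s‖ with hK₂
  set S : ℂ := ∑' d : ℕ, (μ d : ℂ) / (d : ℂ) ^ 2 with hS
  have hK₂0 : 0 ≤ K₂ := intervalIntegral.integral_nonneg hR.le fun s _ => norm_nonneg _
  have hBμ0 : 0 ≤ Bμ := le_trans (norm_nonneg _) (hBμ 0)
  refine ⟨R * K₂ / 8 + 2 * ‖I‖ / R + ‖k 0‖ / 2 * Bμ, fun l hl N hN => ?_⟩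
  -- Möbius rearrangement
  rw [sum_totient_div_mul_eq]
  -- rows beyond `D` vanish
  set D₀ : ℕ := ⌊R / l⌋₊ with hD₀
  set D : ℕ := min N D₀ with hD
  have hDN : D ≤ N := min_le_left _ _
  have hDl : (D : ℝ) * l ≤ R := by
    have h1 : (D : ℝ) ≤ D₀ := by exact_mod_cast min_le_right _ _
    have h2 : (D₀ : ℝ) ≤ R / l := Nat.floor_le (by positivity)
    calc (D : ℝ) * l ≤ (R / l) * l := by gcongr; exact h1.trans h2
      _ = R := by field_simp
  have hDl' : R < (D + 1 : ℝ) * l := by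
    rcases le_or_gt N D₀ with h | h
    · have : D = N := min_eq_left h
      rw [this]
      nlinarith
    · have : D = D₀ := min_eq_right h.le
      rw [this, hD₀]
      have := Nat.lt_floor_add_one (R / l)
      calc R = (R / l) * l := by field_simp
        _ < (⌊R / l⌋₊ + 1 : ℝ) * l := by gcongr
  set row : ℕ → ℂ := fun d => ∑ m ∈ Finset.Ioc 0 (N / d), k (l * (d * m : ℕ)) with hrow
  have hvan : ∀ d ∈ Finset.Ioc 0 N, d ∉ Finset.Ioc 0 D → ((μ d : ℂ) / d) * row d = 0 := by
    intro d hd hdD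
    rw [Finset.mem_Ioc] at hd hdD
    have hDd : D < d := by
      by_contra h; exact hdD ⟨hd.1, not_lt.mp h⟩
    have hd' : D₀ < d := by
      rcases le_or_gt N D₀ with h | h
      · exact absurd (lt_of_lt_of_le (min_eq_left h ▸ hDd) hd.2) (lt_irrefl _)
      · rwa [show D = D₀ from min_eq_right h.le] at hDd
    have hld : R < l * d := by
      have h1 : R / l < d := by
        calc R / l < (⌊R / l⌋₊ : ℝ) + 1 := Nat.lt_floor_add_one _
          _ ≤ d := by exact_mod_cast hd'
      rwa [div_lt_iff₀ hl, mul_comm] at h1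
    have : row d = 0 := by
      refine Finset.sum_eq_zero fun m hm => hkR _ ?_
      rw [Finset.mem_Ioc] at hm
      have : (d : ℝ) ≤ (d * m : ℕ) := by exact_mod_cast Nat.le_mul_of_pos_right d hm.1
      nlinarith
    rw [this, mul_zero]
  rw [← Finset.sum_subset (Finset.Ioc_subset_Ioc_right hDN) hvan]
  -- each remaining row by the trapezoidal rule
  set T : ℕ → ℂ := fun d => ∑ m ∈ Finset.range (N / d + 1 + 1), k (m * (l * d)) with hT
  set E : ℕ → ℂ := fun d => T d - I / (l * d) - k 0 / 2 with hE
  have hrowT : ∀ d ∈ Finset.Ioc 0 D, row d = T d - k 0 := by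
    intro d hd
    rw [Finset.mem_Ioc] at hd
    have hd0 : 0 < d := hd.1
    have hlast : k ((N / d + 1 : ℕ) * (l * d)) = 0 := by
      refine hkR _ ?_
      have h1 : (N : ℝ) < (N / d + 1 : ℕ) * d := by
        exact_mod_cast (mul_comm d _ ▸ Nat.lt_mul_div_succ N hd0 : N < (N / d + 1) * d)
      nlinarith
    rw [hT]; dsimp only
    rw [Finset.sum_range_succ, Finset.sum_range_succ', hrow]; dsimp only
    rw [sum_Ioc_zero_eq_sum_range]
    push_cast at hlast ⊢
    rw [hlast]
    simp only [zero_mul, add_zero]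
    rw [add_sub_cancel_right]
    refine Finset.sum_congr rfl fun i _ => ?_
    congr 1; ring
  have hErr : ∀ d ∈ Finset.Ioc 0 D, ‖E d‖ ≤ (l * d / 8) * K₂ := by
    intro d hd
    rw [Finset.mem_Ioc] at hd
    have hd0 : 0 < d := hd.1
    have ha : 0 < l * d := by positivity
    have hM : R ≤ ((N / d + 1 : ℕ) : ℝ) * (l * d) := by
      have h1 : (N : ℝ) < (N / d + 1 : ℕ) * d := by
        exact_mod_cast (mul_comm d _ ▸ Nat.lt_mul_div_succ N hd0 : N < (N / d + 1) * d)
      nlinarith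
    have := norm_row_sub_le hk hkR ha hM
    rw [hE, hT]
    simpa using this
  -- algebra: split the sum
  have halg : ∑ d ∈ Finset.Ioc 0 D, ((μ d : ℂ) / d) * row d - S * I / l =
      ∑ d ∈ Finset.Ioc 0 D, ((μ d : ℂ) / d) * E d -
        (I / l) * (S - ∑ d ∈ Finset.Ioc 0 D, (μ d : ℂ) / (d : ℂ) ^ 2) -
        (k 0 / 2) * ∑ d ∈ Finset.Ioc 0 D, (μ d : ℂ) / d := by
    have hl' : (l : ℂ) ≠ 0 := by exact_mod_cast hl.ne'
    have e1 : ∀ d ∈ Finset.Ioc 0 D, ((μ d : ℂ) / d) * row d =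
        ((μ d : ℂ) / d) * E d + (I / l) * ((μ d : ℂ) / (d : ℂ) ^ 2) -
          (k 0 / 2) * ((μ d : ℂ) / d) := by
      intro d hd
      have hd0 : (d : ℂ) ≠ 0 := by exact_mod_cast (Finset.mem_Ioc.1 hd).1.ne'
      rw [hrowT d hd, hE]
      field_simp
      ring
    rw [Finset.sum_congr rfl e1, Finset.sum_sub_distrib, Finset.sum_add_distrib,
      ← Finset.mul_sum, ← Finset.mul_sum]
    ring
  rw [halg]
  -- the three bounds
  have b1 : ‖∑ d ∈ Finset.Ioc 0 D, ((μ d : ℂ) / d) * E d‖ ≤ R * K₂ / 8 := by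
    calc ‖∑ d ∈ Finset.Ioc 0 D, ((μ d : ℂ) / d) * E d‖
        ≤ ∑ d ∈ Finset.Ioc 0 D, ‖((μ d : ℂ) / d) * E d‖ := norm_sum_le _ _
      _ ≤ ∑ d ∈ Finset.Ioc 0 D, (l / 8) * K₂ := by
          refine Finset.sum_le_sum fun d hd => ?_
          have hd0 : 0 < d := (Finset.mem_Ioc.1 hd).1
          rw [norm_mul, norm_div, Complex.norm_intCast, Complex.norm_natCast]
          have hμ : (|(μ d : ℝ)| : ℝ) / d ≤ 1 / d := div_le_div_of_nonneg_right
            (by exact_mod_cast ArithmeticFunction.abs_moebius_le_one) (by positivity)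
          have hμ' : |((μ d : ℤ) : ℝ)| / d ≤ 1 / d := hμ
          calc |((μ d : ℤ) : ℝ)| / d * ‖E d‖ ≤ (1 / d) * ((l * d / 8) * K₂) := by
                gcongr
                exact hErr d hd
            _ = (l / 8) * K₂ := by field_simp
      _ = D * ((l / 8) * K₂) := by simp
      _ ≤ R * K₂ / 8 := by nlinarith
  have b2 : ‖(I / l) * (S - ∑ d ∈ Finset.Ioc 0 D, (μ d : ℂ) / (d : ℂ) ^ 2)‖ ≤ 2 * ‖I‖ / R := by
    rw [norm_mul, norm_div, Complex.norm_real, Real.norm_of_nonneg hl.le]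
    have ht := norm_tsum_moebius_div_sq_sub_le D
    have hD1 : (0 : ℝ) < D + 1 := by positivity
    calc ‖I‖ / l * ‖S - ∑ d ∈ Finset.Ioc 0 D, (μ d : ℂ) / (d : ℂ) ^ 2‖
        ≤ ‖I‖ / l * (2 / (D + 1)) := by gcongr
      _ = 2 * ‖I‖ / (l * (D + 1)) := by field_simp
      _ ≤ 2 * ‖I‖ / R := by
          apply div_le_div_of_nonneg_left (by positivity) hR
          nlinarith
  have b3 : ‖(k 0 / 2) * ∑ d ∈ Finset.Ioc 0 D, (μ d : ℂ) / d‖ ≤ ‖k 0‖ / 2 * Bμ := by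
    rw [norm_mul, norm_div]
    norm_num
    gcongr
    exact hBμ D
  calc ‖∑ d ∈ Finset.Ioc 0 D, ((μ d : ℂ) / d) * E d -
        (I / l) * (S - ∑ d ∈ Finset.Ioc 0 D, (μ d : ℂ) / (d : ℂ) ^ 2) -
        (k 0 / 2) * ∑ d ∈ Finset.Ioc 0 D, (μ d : ℂ) / d‖
      ≤ ‖∑ d ∈ Finset.Ioc 0 D, ((μ d : ℂ) / d) * E d‖ +
        ‖(I / l) * (S - ∑ d ∈ Finset.Ioc 0 D, (μ d : ℂ) / (d : ℂ) ^ 2)‖ +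
        ‖(k 0 / 2) * ∑ d ∈ Finset.Ioc 0 D, (μ d : ℂ) / d‖ := norm_sub_le_of_le (norm_sub_le _ _) le_rfl
    _ ≤ R * K₂ / 8 + 2 * ‖I‖ / R + ‖k 0‖ / 2 * Bμ := by linarith

end HorocycleZeroMode

end Literature.NumberTheory.LFunctions
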